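import Summits.KontsevichZagierPeriods.Zeta5Search.WedgeDictionaryCorner
import Summits.KontsevichZagierPeriods.Zeta5Search.WedgeDictionaryPFTransfer
import Mathlib.Tactic.ComputeDegree
import HarnessLib

/-!
# The wedge dictionary on the corner: recurrence and contiguity of the canonical coefficients (cell `pub-zeta5`, P1)

HONEST FRAMING: systematic search; no irrationality claim unless certified.

OUR work (Summit side), P1 seat generation 2, towards the corner case `cornerIdentity` of the cell's conjecture
`wedgeDictionary` (files `WedgeDictionary*.lean`; corner family `WedgeDictionaryCorner.lean`, gen-1 g3).

For the corner `b = (n;0⁷)` the summand of (34) is `R_n(t) = (2t+n+2)/((t+1)_{n+1})⁶` and its partner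
(`b' = b + e₁`) has summand `R'_n(t) = (2t+n+2)(t+1)(t+n+1)/((t+1)_{n+1})⁶`. Creative telescoping IN `t`
(certificates found by the cell, `HOME/code/p1/corner/corner_certs.py`; tiny) gives two rational-function identities

* `p₀(n)R_n + p₁(n)R_{n+1} + p₂(n)R_{n+2} = G(·+1) − G`, `G = x_n(t)/((t+1)_{n+2})⁶`, `deg_t x_n = 8`, with
  `p₂ = (n+2)⁹(n+1)⁵`, `p₁ = (2n+3)(13n²+39n+30)(n+1)⁵`, `p₀ = −3(3n+2)(3n+4)` (`gosper_rec`);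
* `28(3n+1)R'_n + 2(41n³+44n²+21n+4)R_n + 2(n+1)⁹R_{n+1} = H(·+1) − H`, `H = y_n(t)/((t+1)_{n+1})⁶`,
  `y_n(t) = −(84(n+1)⁴ + 240(n+1)³t + 270(n+1)²t² + 140(n+1)t³ + 28t⁴)` (`gosper_contig`).

TRANSFER: `U = Σ_p c_{4,p}` and `W = Σ_p c_{2,p}` are sums of partial-fraction coefficients of a fixed order over
all poles, hence additive and invariant under `t ↦ t+1`; by uniqueness of partial fractions (`BallRivoal.pf_unique`)
both identities pass to `U, W` (THEOREMS, all `n`): `corner_recurrence` — `p₂U_{n+2} + p₁U_{n+1} + p₀U_n = 0`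
(after the gauge `(−1)^n n!⁶`: the level-7 Apéry-like recurrence), and `corner_contiguity` —
`28(3n+1)U'_n + 2(41n³+44n²+21n+4)U_n + 2(n+1)⁹U_{n+1} = 0` with `U'_n, W'_n` the coefficients of the partner
`b' = (n;1,0⁶)`; likewise for `W`. Consequences (`cornerIdentity`, …) in `WedgeDictionaryCornerIdentity.lean`.
-/

noncomputable section

open Finset Polynomial

namespace Summit.KontsevichZagierPeriods.Zeta5Search.WedgeDictionary

open Summit.KontsevichZagierPeriods.Zeta5Search.DualSeries
open Literature.NumberTheory.Transcendental
open Literature.NumberTheory.Transcendental.BallRivoal (pfEval pf_unique poch_pos)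
open Literature.NumberTheory.Irrationality.CressonFischlerRivoal2008 (exists_pf_data)

/-! ### The corner data -/

/-- `(bCorner n)₀ = n` as a natural number. -/
theorem bCorner_zero_toNat (n : ℕ) : (bCorner n 0).toNat = n := by simp [bCorner]

/-- The canonical data of the corner ARE partial-fraction data of `R_n`. -/
theorem isPFData_corner (n : ℕ) : IsPFData (bCorner n) (pfData (bCorner n)) :=
  isPFData_pfData (Classical.choose_spec (exists_isPFData (bCorner n) (inBox_bCorner n)
    (by simp [bCorner]; positivity)))

/-- Evaluation of the corner data: `pfEval = (2t+n+2)/((t+1)_{n+1})⁶` off the poles. -/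
theorem pfEval_corner (n : ℕ) (t : ℚ) (ht : ∀ p, p ≤ n → t + p + 1 ≠ 0) :
    pfEval n 6 (pfData (bCorner n)) t = (2 * t + n + 2) / BallRivoal.poch (t + 1) (n + 1) ^ 6 := by
  have h := isPFData_corner n t (by rw [bCorner_zero_toNat]; exact ht)
  rw [bCorner_zero_toNat, eval_numPoly_bCorner] at h
  exact h

/-- The partner `b' = b + e₁ = (n; 1, 0⁶)` of the corner, literally as in the conjecture. -/
def bCorner' (n : ℕ) : ℕ → ℤ := Function.update (bCorner n) 1 (bCorner n 1 + 1)

/-- `(b')₀ = n`. -/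
theorem bCorner'_zero (n : ℕ) : bCorner' n 0 = n := by
  rw [bCorner', Function.update_of_ne (by norm_num)]; simp [bCorner]

/-- `(b')₀ = n` as a natural number. -/
theorem bCorner'_zero_toNat (n : ℕ) : (bCorner' n 0).toNat = n := by rw [bCorner'_zero]; simp

/-- The partner lies in the box with `Σ_j b'_j ≤ 3b'₀ + 1`. -/
theorem box_bCorner' (n : ℕ) : InBox (bCorner' n) ∧ ∑ j ∈ range 7, bCorner' n (j + 1) ≤ 3 * bCorner' n 0 + 1 :=
  box_update (bCorner n) (inBox_bCorner n) (by rw [dOf_bCorner]; positivity) (by simp) (by simp [bCorner])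

/-- `numPoly_{b'}(t+1) = (2t+n+2)(t+1)(t+n+1)`. -/
theorem eval_numPoly_bCorner' (n : ℕ) (t : ℚ) :
    ((numPoly (bCorner' n)).comp (X + C 1)).eval t = (2 * t + n + 2) * ((t + 1) * (t + n + 1)) := by
  rw [eval_comp, eval_add, eval_X, eval_C, eval_numPoly, bCorner'_zero]
  have h1 : ∀ j ∈ range 7, (BallRivoal.poch (t + 1) (bCorner' n (j + 1)).toNat *
      BallRivoal.poch (t + 1 + (((n : ℤ) - bCorner' n (j + 1) + 1 : ℤ) : ℚ)) (bCorner' n (j + 1)).toNat) =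
      if j = 0 then (t + 1) * (t + n + 1) else 1 := by
    intro j hj
    by_cases hj0 : j = 0
    · subst hj0
      have e1 : bCorner' n 1 = 1 := by simp [bCorner', bCorner]
      rw [e1, if_pos rfl, show (1 : ℤ).toNat = 1 from rfl]
      simp only [BallRivoal.poch, prod_range_one, Nat.cast_zero, add_zero]
      push_cast
      ring
    · have e0 : bCorner' n (j + 1) = 0 := by
        rw [bCorner', Function.update_of_ne (by omega)]; simp [bCorner]
      rw [e0, if_neg hj0, show (0 : ℤ).toNat = 0 from rfl]
      simp only [BallRivoal.poch, prod_range_zero, mul_one]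
  rw [prod_congr rfl h1, prod_ite_eq']
  simp only [mem_range, Nat.ofNat_pos, if_true]
  push_cast
  ring

/-- The canonical data of the partner and their evaluation `R'_n(t) = (2t+n+2)(t+1)(t+n+1)/((t+1)_{n+1})⁶`. -/
theorem pfEval_corner' (n : ℕ) (t : ℚ) (ht : ∀ p, p ≤ n → t + p + 1 ≠ 0) :
    IsPFData (bCorner' n) (pfData (bCorner' n)) ∧
      pfEval n 6 (pfData (bCorner' n)) t =
        (2 * t + n + 2) * ((t + 1) * (t + n + 1)) / BallRivoal.poch (t + 1) (n + 1) ^ 6 := by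
  have hex := exists_isPFData (bCorner' n) (box_bCorner' n).1 (box_bCorner' n).2
  have hc : IsPFData (bCorner' n) (pfData (bCorner' n)) := isPFData_pfData (Classical.choose_spec hex)
  refine ⟨hc, ?_⟩
  have h := hc t (by rw [bCorner'_zero_toNat]; exact ht)
  rw [bCorner'_zero_toNat, eval_numPoly_bCorner'] at h
  exact h

/-! ### The two creative-telescoping certificates (found by the cell; checked by `ring`) -/

/-- Telescoper coefficient `p₀(n) = −3(3n+2)(3n+4)`. -/
def recP0 (n : ℚ) : ℚ := -3 * (3 * n + 2) * (3 * n + 4)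
/-- Telescoper coefficient `p₁(n) = (2n+3)(13n²+39n+30)(n+1)⁵`. -/
def recP1 (n : ℚ) : ℚ := (2 * n + 3) * (13 * n ^ 2 + 39 * n + 30) * (n + 1) ^ 5
/-- Telescoper coefficient `p₂(n) = (n+2)⁹(n+1)⁵`. -/
def recP2 (n : ℚ) : ℚ := (n + 2) ^ 9 * (n + 1) ^ 5

/-- Certificate numerator `x_n(t)` of the recurrence (degree 8 in `t`). -/
def xCert (n t : ℚ) : ℚ :=
  14 * (n + 1) ^ 2 * (n + 2) ^ 4 * (7 * n ^ 2 + 19 * n + 13)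
  + 12 * (n + 1) * (n + 2) ^ 3 * (14 * n ^ 4 + 115 * n ^ 3 + 308 * n ^ 2 + 340 * n + 134) * t
  + 3 * (n + 2) ^ 2 * (240 * n ^ 5 + 1943 * n ^ 4 + 6032 * n ^ 3 + 9070 * n ^ 2 + 6647 * n + 1907) * t ^ 2
  + 2 * (n + 2) * (682 * n ^ 5 + 5407 * n ^ 4 + 16786 * n ^ 3 + 25578 * n ^ 2 + 19169 * n + 5661) * t ^ 3
  + (1471 * n ^ 5 + 11810 * n ^ 4 + 37450 * n ^ 3 + 58660 * n ^ 2 + 45410 * n + 13906) * t ^ 4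
  + 12 * (n + 2) * (3 * n + 4) * (27 * n ^ 2 + 79 * n + 57) * t ^ 5
  + (3 * n + 4) * (131 * n ^ 2 + 424 * n + 338) * t ^ 6
  + 6 * (3 * n + 4) * (5 * n + 8) * t ^ 7 + 3 * (3 * n + 4) * t ^ 8

/-- `x_n` as a polynomial in `ℚ[X]` (for the existence of its partial fractions). -/
def xCertPoly (n : ℚ) : ℚ[X] :=
  C (14 * (n + 1) ^ 2 * (n + 2) ^ 4 * (7 * n ^ 2 + 19 * n + 13))
  + C (12 * (n + 1) * (n + 2) ^ 3 * (14 * n ^ 4 + 115 * n ^ 3 + 308 * n ^ 2 + 340 * n + 134)) * X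
  + C (3 * (n + 2) ^ 2 * (240 * n ^ 5 + 1943 * n ^ 4 + 6032 * n ^ 3 + 9070 * n ^ 2 + 6647 * n + 1907)) * X ^ 2
  + C (2 * (n + 2) * (682 * n ^ 5 + 5407 * n ^ 4 + 16786 * n ^ 3 + 25578 * n ^ 2 + 19169 * n + 5661)) * X ^ 3
  + C (1471 * n ^ 5 + 11810 * n ^ 4 + 37450 * n ^ 3 + 58660 * n ^ 2 + 45410 * n + 13906) * X ^ 4
  + C (12 * (n + 2) * (3 * n + 4) * (27 * n ^ 2 + 79 * n + 57)) * X ^ 5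
  + C ((3 * n + 4) * (131 * n ^ 2 + 424 * n + 338)) * X ^ 6
  + C (6 * (3 * n + 4) * (5 * n + 8)) * X ^ 7 + C (3 * (3 * n + 4)) * X ^ 8

/-- `eval` of `xCertPoly`. -/
theorem eval_xCertPoly (n t : ℚ) : (xCertPoly n).eval t = xCert n t := by
  simp only [xCertPoly, xCert, eval_add, eval_mul, eval_C, eval_X, eval_pow]

/-- `deg x_n ≤ 8`. -/
theorem natDegree_xCertPoly_le (n : ℚ) : (xCertPoly n).natDegree ≤ 8 := by
  unfold xCertPoly; compute_degree

/-- **The Gosper identity behind the recurrence**: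
`p₀N₀ + p₁N₁ + p₂N₂ = (t+1)⁶x_n(t+1) − (t+n+3)⁶x_n(t)` with `N₀ = (2t+n+2)(t+n+2)⁶(t+n+3)⁶`,
`N₁ = (2t+n+3)(t+n+3)⁶`, `N₂ = 2t+n+4`. -/
theorem gosper_rec (n t : ℚ) :
    recP0 n * ((2 * t + n + 2) * (t + n + 2) ^ 6 * (t + n + 3) ^ 6) + recP1 n * ((2 * t + n + 3) * (t + n + 3) ^ 6)
        + recP2 n * (2 * t + n + 4) = (t + 1) ^ 6 * xCert n (t + 1) - (t + n + 3) ^ 6 * xCert n t := by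
  unfold recP0 recP1 recP2 xCert; ring

/-- Certificate numerator `y_n(t)` of the contiguity relation. -/
def yCert (n t : ℚ) : ℚ :=
  -(84 * (n + 1) ^ 4 + 240 * (n + 1) ^ 3 * t + 270 * (n + 1) ^ 2 * t ^ 2 + 140 * (n + 1) * t ^ 3 + 28 * t ^ 4)

/-- `y_n` as a polynomial. -/
def yCertPoly (n : ℚ) : ℚ[X] :=
  C (-(84 * (n + 1) ^ 4)) + C (-(240 * (n + 1) ^ 3)) * X + C (-(270 * (n + 1) ^ 2)) * X ^ 2
    + C (-(140 * (n + 1))) * X ^ 3 + C (-28) * X ^ 4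

/-- `eval` of `yCertPoly`. -/
theorem eval_yCertPoly (n t : ℚ) : (yCertPoly n).eval t = yCert n t := by
  simp only [yCertPoly, yCert, eval_add, eval_mul, eval_C, eval_X, eval_pow]; ring

/-- `deg y_n ≤ 4`. -/
theorem natDegree_yCertPoly_le (n : ℚ) : (yCertPoly n).natDegree ≤ 4 := by
  unfold yCertPoly; compute_degree

/-- **The Gosper identity behind the contiguity relation**:
`[28(3n+1)(t+1)(t+n+1) + 2(41n³+44n²+21n+4)](2t+n+2)(t+n+2)⁶ + 2(n+1)⁹(2t+n+3) = (t+1)⁶y_n(t+1) − (t+n+2)⁶y_n(t)`. -/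
theorem gosper_contig (n t : ℚ) :
    (28 * (3 * n + 1) * ((t + 1) * (t + n + 1)) + 2 * (41 * n ^ 3 + 44 * n ^ 2 + 21 * n + 4))
          * (2 * t + n + 2) * (t + n + 2) ^ 6 + 2 * (n + 1) ^ 9 * (2 * t + n + 3)
      = (t + 1) ^ 6 * yCert n (t + 1) - (t + n + 2) ^ 6 * yCert n t := by
  unfold yCert; ring

/-! ### Partial fractions of the certificates -/

/-- Partial-fraction data of `G = x_n/((t+1)_{n+2})⁶` exist (degree `8 < 6(n+2)`). -/
theorem exists_pf_xCert (n : ℕ) : ∃ d : ℕ → ℕ → ℚ, ∀ t : ℚ, (∀ p, p ≤ n + 1 → t + p + 1 ≠ 0) →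
    pfEval (n + 1) 6 d t = xCert n t / BallRivoal.poch (t + 1) (n + 2) ^ 6 := by
  have hdeg : (xCertPoly n).degree < ((6 * (n + 1 + 1) : ℕ) : WithBot ℕ) :=
    (degree_le_of_natDegree_le (natDegree_xCertPoly_le n)).trans_lt (by exact_mod_cast (by omega))
  obtain ⟨d, hd⟩ := exists_pf_data (n + 1) 6 (by norm_num) (xCertPoly n) hdeg
  exact ⟨d, fun t ht => by rw [hd t ht, eval_xCertPoly]⟩

/-- Partial-fraction data of `H = y_n/((t+1)_{n+1})⁶` exist (degree `4 < 6(n+1)`). -/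
theorem exists_pf_yCert (n : ℕ) : ∃ d : ℕ → ℕ → ℚ, ∀ t : ℚ, (∀ p, p ≤ n → t + p + 1 ≠ 0) →
    pfEval n 6 d t = yCert n t / BallRivoal.poch (t + 1) (n + 1) ^ 6 := by
  have hdeg : (yCertPoly n).degree < ((6 * (n + 1) : ℕ) : WithBot ℕ) :=
    (degree_le_of_natDegree_le (natDegree_yCertPoly_le n)).trans_lt (by exact_mod_cast (by omega))
  obtain ⟨d, hd⟩ := exists_pf_data n 6 (by norm_num) (yCertPoly n) hdeg
  exact ⟨d, fun t ht => by rw [hd t ht, eval_yCertPoly]⟩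

/-! ### The rational identities at natural arguments -/

/-- The recurrence identity for the summands: `p₀R_n(t) + p₁R_{n+1}(t) + p₂R_{n+2}(t) + G(t) − G(t+1) = 0`, `t ∈ ℕ`. -/
theorem rec_identity (n t : ℕ) :
    recP0 n * ((2 * (t : ℚ) + n + 2) / BallRivoal.poch ((t : ℚ) + 1) (n + 1) ^ 6)
      + recP1 n * ((2 * (t : ℚ) + (((n + 1 : ℕ)) : ℚ) + 2) / BallRivoal.poch ((t : ℚ) + 1) (n + 1 + 1) ^ 6)
      + recP2 n * ((2 * (t : ℚ) + (((n + 2 : ℕ)) : ℚ) + 2) / BallRivoal.poch ((t : ℚ) + 1) (n + 2 + 1) ^ 6)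
      + xCert n t / BallRivoal.poch ((t : ℚ) + 1) (n + 2) ^ 6
      - xCert n ((t : ℚ) + 1) / BallRivoal.poch ((t : ℚ) + 1 + 1) (n + 2) ^ 6 = 0 := by
  set P := BallRivoal.poch ((t : ℚ) + 1) (n + 1) with hP
  have hPpos : 0 < P := poch_pos (by positivity) _
  have e2 : BallRivoal.poch ((t : ℚ) + 1) (n + 1 + 1) = P * ((t : ℚ) + n + 2) := by
    rw [poch_succ_right]; push_cast; ring
  have e2' : BallRivoal.poch ((t : ℚ) + 1) (n + 2) = P * ((t : ℚ) + n + 2) := e2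
  have e3 : BallRivoal.poch ((t : ℚ) + 1) (n + 2 + 1) = P * ((t : ℚ) + n + 2) * ((t : ℚ) + n + 3) := by
    rw [poch_succ_right, e2']; push_cast; ring
  have e4 : BallRivoal.poch ((t : ℚ) + 1 + 1) (n + 2) * ((t : ℚ) + 1) = P * ((t : ℚ) + n + 2) * ((t : ℚ) + n + 3) := by
    rw [← e3, poch_succ_left ((t : ℚ) + 1) (n + 2)]; ring
  have h1 : ((t : ℚ) + 1) ≠ 0 := by positivity
  have h2 : ((t : ℚ) + n + 2) ≠ 0 := by positivity
  have h3 : ((t : ℚ) + n + 3) ≠ 0 := by positivity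
  have e4' : BallRivoal.poch ((t : ℚ) + 1 + 1) (n + 2) = P * ((t : ℚ) + n + 2) * ((t : ℚ) + n + 3) / ((t : ℚ) + 1) := by
    rw [← e4, mul_div_cancel_right₀ _ h1]
  rw [e2, e3, e4']
  try rw [e2']
  push_cast
  have hid := gosper_rec (n : ℚ) (t : ℚ)
  field_simp
  linear_combination hid

/-- The contiguity identity for the summands:
`28(3n+1)R'_n(t) + 2(41n³+44n²+21n+4)R_n(t) + 2(n+1)⁹R_{n+1}(t) + H(t) − H(t+1) = 0`, `t ∈ ℕ`. -/
theorem contig_identity (n t : ℕ) :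
    28 * (3 * (n : ℚ) + 1) * ((2 * (t : ℚ) + n + 2) * (((t : ℚ) + 1) * ((t : ℚ) + n + 1))
        / BallRivoal.poch ((t : ℚ) + 1) (n + 1) ^ 6)
      + 2 * (41 * (n : ℚ) ^ 3 + 44 * (n : ℚ) ^ 2 + 21 * n + 4)
        * ((2 * (t : ℚ) + n + 2) / BallRivoal.poch ((t : ℚ) + 1) (n + 1) ^ 6)
      + 2 * ((n : ℚ) + 1) ^ 9
        * ((2 * (t : ℚ) + (((n + 1 : ℕ)) : ℚ) + 2) / BallRivoal.poch ((t : ℚ) + 1) (n + 1 + 1) ^ 6)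
      + yCert n t / BallRivoal.poch ((t : ℚ) + 1) (n + 1) ^ 6
      - yCert n ((t : ℚ) + 1) / BallRivoal.poch ((t : ℚ) + 1 + 1) (n + 1) ^ 6 = 0 := by
  set P := BallRivoal.poch ((t : ℚ) + 1) (n + 1) with hP
  have hPpos : 0 < P := poch_pos (by positivity) _
  have e2 : BallRivoal.poch ((t : ℚ) + 1) (n + 1 + 1) = P * ((t : ℚ) + n + 2) := by
    rw [poch_succ_right]; push_cast; ring
  have e4 : BallRivoal.poch ((t : ℚ) + 1 + 1) (n + 1) * ((t : ℚ) + 1) = P * ((t : ℚ) + n + 2) := by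
    rw [← e2, poch_succ_left ((t : ℚ) + 1) (n + 1)]; ring
  have h1 : ((t : ℚ) + 1) ≠ 0 := by positivity
  have h2 : ((t : ℚ) + n + 2) ≠ 0 := by positivity
  have e4' : BallRivoal.poch ((t : ℚ) + 1 + 1) (n + 1) = P * ((t : ℚ) + n + 2) / ((t : ℚ) + 1) := by
    rw [← e4, mul_div_cancel_right₀ _ h1]
  rw [e2, e4']
  push_cast
  have hid := gosper_contig (n : ℚ) (t : ℚ)
  field_simp
  linear_combination hid

/-! ### Transfer to the canonical coefficients -/

/-- **Second-order recurrence of the corner coefficients** (all `n`):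
`p₂(n)U_{n+2} + p₁(n)U_{n+1} + p₀(n)U_n = 0` and `p₂(n)W_{n+2} + p₁(n)W_{n+1} + p₀(n)W_n = 0`. -/
theorem corner_recurrence (n : ℕ) :
    recP2 n * coeffU (bCorner (n + 2)) + recP1 n * coeffU (bCorner (n + 1)) + recP0 n * coeffU (bCorner n) = 0 ∧
    recP2 n * coeffW (bCorner (n + 2)) + recP1 n * coeffW (bCorner (n + 1)) + recP0 n * coeffW (bCorner n) = 0 := by
  obtain ⟨d, hd⟩ := exists_pf_xCert n
  set c0 := pfData (bCorner n)
  set c1 := pfData (bCorner (n + 1))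
  set c2 := pfData (bCorner (n + 2))
  set e : ℕ → ℕ → ℚ := fun o p => recP0 n * padData n c0 o p + recP1 n * padData (n + 1) c1 o p
    + recP2 n * c2 o p + padData (n + 1) d o p - shiftUp d o p with he_def
  have he : ∀ t : ℕ, pfEval (n + 2) 6 e t = 0 := by
    intro t
    have ht : ∀ m p : ℕ, p ≤ m → (t : ℚ) + p + 1 ≠ 0 := fun m p _ => by positivity
    have ht1 : ∀ m p : ℕ, p ≤ m → (t : ℚ) + 1 + p + 1 ≠ 0 := fun m p _ => by positivity
    rw [he_def, pfEval_comb, pfEval_padData (by omega), pfEval_padData (by omega), pfEval_padData (by omega),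
      show n + 2 = (n + 1) + 1 from rfl, pfEval_shiftUp, pfEval_corner n _ (ht n), pfEval_corner (n + 1) _ (ht _),
      pfEval_corner (n + 1 + 1) _ (ht _), hd _ (ht _), hd _ (ht1 _)]
    have := rec_identity n t
    push_cast at this ⊢
    linear_combination this
  have hsum : ∀ {o : ℕ}, o < 6 →
      recP0 n * ∑ p ∈ range (n + 1), c0 o p + recP1 n * ∑ p ∈ range (n + 2), c1 o p
        + recP2 n * ∑ p ∈ range (n + 3), c2 o p = 0 := by
    intro o ho
    have hz := sum_eq_zero_of_pfEval_zero (n + 2) 6 e he ho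
    simp only [he_def, sum_add_distrib, sum_sub_distrib, ← mul_sum] at hz
    rw [sum_padData (by omega), sum_padData (by omega), sum_padData (by omega),
      show n + 2 + 1 = (n + 1) + 2 from rfl, sum_shiftUp] at hz
    linear_combination hz
  have hU : ∀ m, coeffU (bCorner m) = ∑ p ∈ range (m + 1), pfData (bCorner m) 4 p := fun m => by
    rw [coeffU_eq (isPFData_corner m), bCorner_zero_toNat]
  have hW : ∀ m, coeffW (bCorner m) = ∑ p ∈ range (m + 1), pfData (bCorner m) 2 p := fun m => by
    rw [coeffW_eq (isPFData_corner m), bCorner_zero_toNat]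
  refine ⟨?_, ?_⟩
  · rw [hU, hU, hU]; linear_combination hsum (show 4 < 6 by norm_num)
  · rw [hW, hW, hW]; linear_combination hsum (show 2 < 6 by norm_num)

/-- **Contiguity of the corner coefficients** (all `n`): with `U'_n = U(b')`, `W'_n = W(b')`, `b' = (n;1,0⁶)`,
`28(3n+1)U'_n + 2(41n³+44n²+21n+4)U_n + 2(n+1)⁹U_{n+1} = 0` and the same for `W`. -/
theorem corner_contiguity (n : ℕ) :
    28 * (3 * (n : ℚ) + 1) * coeffU (bCorner' n) + 2 * (41 * (n : ℚ) ^ 3 + 44 * (n : ℚ) ^ 2 + 21 * n + 4)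
        * coeffU (bCorner n) + 2 * ((n : ℚ) + 1) ^ 9 * coeffU (bCorner (n + 1)) = 0 ∧
    28 * (3 * (n : ℚ) + 1) * coeffW (bCorner' n) + 2 * (41 * (n : ℚ) ^ 3 + 44 * (n : ℚ) ^ 2 + 21 * n + 4)
        * coeffW (bCorner n) + 2 * ((n : ℚ) + 1) ^ 9 * coeffW (bCorner (n + 1)) = 0 := by
  obtain ⟨d, hd⟩ := exists_pf_yCert n
  set c' := pfData (bCorner' n)
  set c0 := pfData (bCorner n)
  set c1 := pfData (bCorner (n + 1))
  set e : ℕ → ℕ → ℚ := fun o p => 28 * (3 * (n : ℚ) + 1) * padData n c' o p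
    + 2 * (41 * (n : ℚ) ^ 3 + 44 * (n : ℚ) ^ 2 + 21 * n + 4) * padData n c0 o p
    + 2 * ((n : ℚ) + 1) ^ 9 * c1 o p + padData n d o p - shiftUp d o p with he_def
  have he : ∀ t : ℕ, pfEval (n + 1) 6 e t = 0 := by
    intro t
    have ht : ∀ m p : ℕ, p ≤ m → (t : ℚ) + p + 1 ≠ 0 := fun m p _ => by positivity
    have ht1 : ∀ m p : ℕ, p ≤ m → (t : ℚ) + 1 + p + 1 ≠ 0 := fun m p _ => by positivity
    rw [he_def, pfEval_comb, pfEval_padData (by omega), pfEval_padData (by omega), pfEval_padData (by omega),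
      pfEval_shiftUp, (pfEval_corner' n _ (ht n)).2, pfEval_corner n _ (ht n), pfEval_corner (n + 1) _ (ht _),
      hd _ (ht _), hd _ (ht1 _)]
    have := contig_identity n t
    push_cast at this ⊢
    linear_combination this
  have hsum : ∀ {o : ℕ}, o < 6 →
      28 * (3 * (n : ℚ) + 1) * ∑ p ∈ range (n + 1), c' o p
        + 2 * (41 * (n : ℚ) ^ 3 + 44 * (n : ℚ) ^ 2 + 21 * n + 4) * ∑ p ∈ range (n + 1), c0 o p
        + 2 * ((n : ℚ) + 1) ^ 9 * ∑ p ∈ range (n + 2), c1 o p = 0 := by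
    intro o ho
    have hz := sum_eq_zero_of_pfEval_zero (n + 1) 6 e he ho
    simp only [he_def, sum_add_distrib, sum_sub_distrib, ← mul_sum] at hz
    rw [sum_padData (by omega), sum_padData (by omega), sum_padData (by omega), sum_shiftUp] at hz
    linear_combination hz
  have hc' := fun t : ℚ => (pfEval_corner' n 0 (fun p _ => by positivity)).1
  have hU' : coeffU (bCorner' n) = ∑ p ∈ range (n + 1), c' 4 p := by
    rw [coeffU_eq (hc' 0), bCorner'_zero_toNat]
  have hW' : coeffW (bCorner' n) = ∑ p ∈ range (n + 1), c' 2 p := by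
    rw [coeffW_eq (hc' 0), bCorner'_zero_toNat]
  have hU : ∀ m, coeffU (bCorner m) = ∑ p ∈ range (m + 1), pfData (bCorner m) 4 p := fun m => by
    rw [coeffU_eq (isPFData_corner m), bCorner_zero_toNat]
  have hW : ∀ m, coeffW (bCorner m) = ∑ p ∈ range (m + 1), pfData (bCorner m) 2 p := fun m => by
    rw [coeffW_eq (isPFData_corner m), bCorner_zero_toNat]
  refine ⟨?_, ?_⟩
  · rw [hU', hU, hU]; linear_combination hsum (show 4 < 6 by norm_num)
  · rw [hW', hW, hW]; linear_combination hsum (show 2 < 6 by norm_num)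

end Summit.KontsevichZagierPeriods.Zeta5Search.WedgeDictionary
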